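import Summits.ABC.ABC.Theses.PadicPrimesW80TwoThirds
import Summits.ABC.StewartYu.YuNinetyW80Transfer
import Summits.ABC.StewartYu.PadicTwistPMFinal

/-! # Crux `W80OneModFour` (stmt-ABC-19487, routes `PadicPrimesW80TwoThirds` / `PadicPrimesW80OddRadOne`)
# — line `parity-twist-w80` (lead p3-g2): the registered skeleton with its one stub PROVED

`Summits/ABC/ABC/Theorems/PadicPrimesW80TwoThirdsW80OneModFour.lean` — cell `abc-stewartyu` (filed by
p1-g5 under the planner's contingency 2026-08-26 10:32Z; the line, the skeleton and the whole ± machine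
are p3-g2's).  The registered stub `stub_coreBoundPM` (the ± core bound `TwistSetup.TwistCoreBoundPM C`
for an admissible constant) is the landed theorem `Summit.ABC.StewartYu.TwistSetup.coreBoundPM_holds`
(`PadicTwistPMFinal.lean`: p3's ± machine `PadicTwistPM{Bridge,KStep,ExpClass,HalfValues,HalfSeparation,
Main,Descent,HalfStep,Adapters,Exists,CoreBound,Engine,Roots,Assembly,HalfProvider}` on p2's re-landed
any-order chain `PadicTwist{Setup,…,Siegel}`, packed at p1's `(log p)`-ledger with the sharp half-point
sizes `PadicW80ParLPM`/`PadicW80SizesLPM`/`PadicTwistPMPack`); the engine step is p3's reduction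
`engineW80One_of_coreBoundPM`, and the composition is p3's transfer `YuNinetyW80.oneModFour_of_w80Engine`
(`αⱼ = qⱼ`, `Vⱼ = log p·log max(4,qⱼ)`, `W = log B·log p`, `c₅ = 41c₁`).  Everything is [folklore] assembly.
-/

set_option linter.dupNamespace false

namespace Summit.ABC.ABC.Cruxes.W80OneModFour.ParityTwistW80

open Summit.ABC.ABC.Theses.PadicPrimesW80TwoThirds

/-- STUB (load-bearing — PROVED): **the ± core bound from the parameter packs**,
`TwistSetup.TwistCoreBoundPM C` for an admissible constant `C` (`2 ≤ C m ≤ c₁^m m^m` for `m ≥ 1`): the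
landed `Summit.ABC.StewartYu.TwistSetup.coreBoundPM_holds` (`C m = 2·Cw m`, `c₁ = 2⁷⁰`; `main_pm` with
HalfStepPM ← `halfStepPM_of_numerics`, SiegelPM ← `siegelPM_of_siegel`, EndgamePM ← `endgamePM_of_numbers`,
`d = 0` ← `coreBound_of_d_zero_pm`, p1's `(log p)`-ledger with `Mcl = G`, Liouville exponent `2^{d+2}`).
[folklore] -/
theorem stub_coreBoundPM : ∃ (C : ℕ → ℝ) (c₁ : ℝ), 1 ≤ c₁ ∧ (∀ m, 1 ≤ m → 2 ≤ C m) ∧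
    (∀ m, 1 ≤ m → C m ≤ c₁ ^ m * (m : ℝ) ^ m) ∧ Summit.ABC.StewartYu.TwistSetup.TwistCoreBoundPM C :=
  Summit.ABC.StewartYu.TwistSetup.coreBoundPM_holds

/-- COMPOSITION: the crux BY NAME — the registered stub `stub_coreBoundPM`, p3's reduction
`TwistSetup.engineW80One_of_coreBoundPM` (the Waldschmidt-shape twist engine at `p ≡ 1 (mod 4)`) and p3's
transfer `YuNinetyW80.oneModFour_of_w80Engine`. [folklore] -/
theorem W80OneModFour_of : W80OneModFour := by
  obtain ⟨C, c₁, hc₁, hC2, henv, hcore⟩ := stub_coreBoundPM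
  exact Summit.ABC.StewartYu.YuNinetyW80.oneModFour_of_w80Engine
    (Summit.ABC.StewartYu.TwistSetup.engineW80One_of_coreBoundPM hc₁ hC2 henv hcore)

end Summit.ABC.ABC.Cruxes.W80OneModFour.ParityTwistW80

namespace Summit.ABC.ABC.Theorems

/-- **Item `W80OneModFour` (stmt-ABC-19487)**: the Waldschmidt-shape `p`-adic bound for rational
primes at `p ≡ 1 (mod 4)`: there is `c₅` such that for every prime `p ≡ 1 (mod 4)`, every finite non-empty
set `S` of primes `q ≠ p`, exponents `|e_q| ≤ B` (`B ≥ 3`) with `∏ q^{e_q} ≠ 1`: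
`ord_p(∏_{q∈S} q^{e_q} − 1) < (c₅·#S)^{#S} · p² · (log B + log log A)·log log A · ∏_{q∈S} log max(4,q)`,
`A = max(4, max S)`. [folklore] -/
theorem padicPrimesW80TwoThirds_w80OneModFour_proof :
    Summit.ABC.ABC.Theses.PadicPrimesW80TwoThirds.W80OneModFour :=
  Summit.ABC.ABC.Cruxes.W80OneModFour.ParityTwistW80.W80OneModFour_of

end Summit.ABC.ABC.Theorems
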